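import Summits.CriticalPhenomena.PercolationContinuityZ3.Theorems.PercNearOneGluingNearOneGluingKnLemma3i
import Summits.CriticalPhenomena.PercolationContinuityZ3.Theorems.PercNearOneGluingAdditiveGluingKnLemma3Mixed
import HarnessLib

/-! # Crux `PercNearOneGluing.AdditiveGluing` (stmt-CriticalPhenomena-4576) — Kozma–Nitzan's Lemma 3(i) RESTRICTED to
# `{C_{a₁} ∩ X = ∅}` (van den Berg–Häggström–Kahn conditioning on the weak cluster)

Support file (`--supports stmt-CriticalPhenomena-4576`; task png-dp-al5); no definitions, no named facts.
`μ = prodBernoulli w` on the bond configurations of a finite weighted graph, `C_v` the open edge cluster.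

**Theorem (`knLemma3i_restricted`).**  Let `M = {a₁ ↮ X}` (`a₁ ∉ X`), `Q` increasing and determined by `C_{a₂}`,
`d ≥ 0`.  If `μ(M ∩ {a₁ ↔ b}) ≤ μ(M ∩ {a₂ ↔ b}) + d` then `μ(M ∩ {a₁ ↔ b} ∩ Q) ≤ μ(M ∩ {a₂ ↔ b} ∩ Q) + d`.
For `X = ∅` this is Kozma–Nitzan's Lemma 3(i) (`knLemma3i`); the point is that BOTH the hypothesis and the conclusion are
restricted to the event that the WEAK vertex `a₁` is not joined to `X` — the form in which hypotheses of the crux survive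
the deletion/gluing steps of the AL5 ladder (task notes: "restricted transfer"; the analogous statement with the
restriction on a third vertex is false).

**Proof.**  Exactly KN's proof of Lemma 3 (pp. 6–7) on `N = M ∩ {a₁ ↮ a₂} = {C_{a₁} ∩ (X ∪ {a₂}) = ∅}`, with the two
correlation inequalities supplied by a version of BHK 2006 Thm. 1.5 CONDITIONED ON `{C_t ∩ X = ∅}` (`t = a₁`, `s = a₂ ∈ X`)
instead of `{s ↮ t}` (`rbhk_twoCluster_avoid`): functions increasing in `C_s` and decreasing in `C_t` are positively
associated given `{C_t ∩ X = ∅}`.  Its proof is BHK's proof of Thm. 1.5 (pp. 7–8) verbatim with the roles of `s, t`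
exchanged: condition on `C_t = W` (display (10), here `rbhk_sum_cond_cluster`), Harris in the fresh variables off `W̄`,
monotonicity of the conditional averages in `W`, and BHK Thm. 1.3 for `C_t` given `{C_t ∩ X = ∅}` (proved in the tree,
`BHK2006_clusterConditionalPositiveAssociation_holds`).
[cite: VandenbergHaggstromKahn2005, Thm. 1.3 (p. 6), Thm. 1.5 (pp. 7–8)] [cite: KozmaNitzan2024, Lemma 3 (pp. 6–7)]
-/

namespace Summit.CriticalPhenomena.PercolationContinuityZ3.Theorems

open MeasureTheory Set
open Literature.Probability.LatticeModels (prodBernoulli)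
open Literature.Probability.Percolation
open Literature.Probability.Percolation.BHK2006
open DecisionTree (ind ind_of_mem ind_of_not_mem ind_nonneg)

noncomputable section
open Classical

section RBHK

variable {V : Type*} [Fintype V]

/-- **BHK's display (10), conditioning on the cluster of `t`, on the event `{C_t ∩ X = ∅}`** (`s ∈ X`): for any `H`,
`E[H(C_t, C_s) 1_D] = Σ_W P(C_t = W, D) E[H(W, C_s) | C_t = W]` with `E[H(W, C_s) | C_t = W] = Σ_η weight(η) H(W, C_s(η ∖ W̄))`
computed in fresh variables off `W̄`.  (`BHK2006.sum_cond_cluster` is the case `X = {s}`.)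
[cite: VandenbergHaggstromKahn2005, §1 pp. 7–8, display (10)] -/
theorem rbhk_sum_cond_cluster (w : Sym2 V → ℝ) (hm : ∑ ω, weight w ω = 1) (t s : V) (X : Set V)
    (hsX : s ∈ X) (H : Set (Sym2 V) → Set (Sym2 V) → ℝ) {D : Set (Set (Sym2 V))}
    (hD : ∀ ω, ω ∈ D ↔ ∀ x ∈ X, ¬ (openGraph ω).Reachable t x) :
    ∑ ω, weight w ω * (H (openEdgeCluster ω t) (openEdgeCluster ω s) * ind D ω) =
      ∑ ω, weight w ω * ((∑ η, weight w η * H (openEdgeCluster ω t) (openEdgeCluster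
        (η \ {e | ∃ v ∈ e, v = t ∨ ∃ e' ∈ openEdgeCluster ω t, v ∈ e'}) s)) * ind D ω) := by
  have key : ∀ W : Set (Sym2 V),
      ∑ ω, (if openEdgeCluster ω t = W then
          weight w ω * (H W (openEdgeCluster ω s) * ind D ω) else 0) =
      ∑ ω, (if openEdgeCluster ω t = W then
          weight w ω * ((∑ η, weight w η * H W (openEdgeCluster
            (η \ {e | ∃ v ∈ e, v = t ∨ ∃ e' ∈ W, v ∈ e'}) s)) * ind D ω) else 0) := by
    intro W
    by_cases hX : ∃ x ∈ X, x = t ∨ ∃ e ∈ W, x ∈ e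
    · -- on `{C_t = W}`, `t` is joined to some `x ∈ X`: both sides vanish termwise
      obtain ⟨x, hxX, hx⟩ := hX
      refine Finset.sum_congr rfl fun ω _ => ?_
      split_ifs with hW
      · have hr : (openGraph ω).Reachable t x := by
          rw [reachable_iff_exists_mem_openEdgeCluster, hW]; exact hx
        have hnD : ω ∉ D := fun h => (hD ω).1 h x hxX hr
        simp only [ind_of_not_mem hnD, mul_zero]
      · rfl
    · have hs : ¬ (s = t ∨ ∃ e ∈ W, s ∈ e) := fun h => hX ⟨s, hsX, h⟩
      set A : Set (Sym2 V) := {e | ∃ v ∈ e, v = t ∨ ∃ e' ∈ W, v ∈ e'} with hA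
      set Φ : Set (Sym2 V) → Set (Sym2 V) → ℝ := fun ζ η =>
        if openEdgeCluster ζ t = W then H W (openEdgeCluster (η \ A) s) else 0 with hΦ
      have hind : ∀ ω, openEdgeCluster ω t = W → ind D ω = 1 := by
        intro ω hW
        refine ind_of_mem ((hD ω).2 fun x hxX hr => hX ⟨x, hxX, ?_⟩)
        rwa [reachable_iff_exists_mem_openEdgeCluster, hW] at hr
      have h1 : ∀ ω, (if openEdgeCluster ω t = W then
          weight w ω * (H W (openEdgeCluster ω s) * ind D ω) else 0) =
          weight w ω * Φ (ω ∩ A) (ω \ A) := by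
        intro ω
        simp only [hΦ, hA, openEdgeCluster_inter_bar_eq_iff, openEdgeCluster_sdiff_sdiff]
        split_ifs with hW
        · rw [hind ω hW, mul_one, openEdgeCluster_eq_sdiff_bar hW hs]
        · rw [mul_zero]
      have h2 : ∀ ω, weight w ω * ∑ ω', weight w ω' * Φ (ω ∩ A) (ω' \ A) =
          (if openEdgeCluster ω t = W then
            weight w ω * ((∑ η, weight w η * H W (openEdgeCluster (η \ A) s)) * ind D ω)
          else 0) := by
        intro ω
        simp only [hΦ, hA, openEdgeCluster_inter_bar_eq_iff, openEdgeCluster_sdiff_sdiff]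
        split_ifs with hW
        · rw [hind ω hW, mul_one]
        · simp
      calc ∑ ω, (if openEdgeCluster ω t = W then
              weight w ω * (H W (openEdgeCluster ω s) * ind D ω) else 0)
          = (∑ ω, weight w ω) * ∑ ω, weight w ω * Φ (ω ∩ A) (ω \ A) := by
            rw [hm, one_mul]; exact Finset.sum_congr rfl fun ω _ => h1 ω
        _ = ∑ ω, weight w ω * ∑ ω', weight w ω' * Φ (ω ∩ A) (ω' \ A) := blockFubini w A Φ
        _ = _ := Finset.sum_congr rfl fun ω _ => h2 ω
  calc ∑ ω, weight w ω * (H (openEdgeCluster ω t) (openEdgeCluster ω s) * ind D ω)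
      = ∑ ω, ∑ W, (if openEdgeCluster ω t = W then
          weight w ω * (H W (openEdgeCluster ω s) * ind D ω) else 0) :=
        Finset.sum_congr rfl fun ω _ => (Fintype.sum_ite_eq (openEdgeCluster ω t)
          fun W => weight w ω * (H W (openEdgeCluster ω s) * ind D ω)).symm
    _ = ∑ W, ∑ ω, (if openEdgeCluster ω t = W then
          weight w ω * (H W (openEdgeCluster ω s) * ind D ω) else 0) := Finset.sum_comm
    _ = ∑ W, ∑ ω, (if openEdgeCluster ω t = W then
          weight w ω * ((∑ η, weight w η * H W (openEdgeCluster
            (η \ {e | ∃ v ∈ e, v = t ∨ ∃ e' ∈ W, v ∈ e'}) s)) * ind D ω) else 0) :=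
        Finset.sum_congr rfl fun W _ => key W
    _ = ∑ ω, ∑ W, (if openEdgeCluster ω t = W then
          weight w ω * ((∑ η, weight w η * H W (openEdgeCluster
            (η \ {e | ∃ v ∈ e, v = t ∨ ∃ e' ∈ W, v ∈ e'}) s)) * ind D ω) else 0) :=
        Finset.sum_comm
    _ = _ :=
        Finset.sum_congr rfl fun ω _ => Fintype.sum_ite_eq (openEdgeCluster ω t)
          fun W => weight w ω * ((∑ η, weight w η * H W (openEdgeCluster
            (η \ {e | ∃ v ∈ e, v = t ∨ ∃ e' ∈ W, v ∈ e'}) s)) * ind D ω)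

/-- **BHK 2006 Thm. 1.5 conditioned on `{C_t ∩ X = ∅}`** (`s ∈ X`, `t ∉ X`): functions of `(C_s, C_t)` that are increasing
in `C_s` and decreasing in `C_t` are positively associated given that the open cluster of `t` avoids `X` — in the
denominator-free form `(∫_N f)(∫_N g) ≤ μ(N) ∫_N f g`, `N = {ω | ∀ x ∈ X, ¬ t ↔ x}`.  (BHK's Thm. 1.5 is `X = {s}`; the
printed proof, pp. 7–8, goes through with the roles of `s` and `t` exchanged: condition on `C_t = W`, Harris off `W̄`,
Thm. 1.3 for `C_t` given `{C_t ∩ X = ∅}`.)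
[cite: VandenbergHaggstromKahn2005, Thm. 1.5 (pp. 7–8), Thm. 1.3 (p. 6)] -/
theorem rbhk_twoCluster_avoid (w : Sym2 V → unitInterval) (t s : V) (X : Set V) (hsX : s ∈ X) (htX : t ∉ X)
    (F G : Set (Sym2 V) → Set (Sym2 V) → ℝ)
    (hF1 : ∀ D, Monotone fun C => F C D) (hF2 : ∀ C, Antitone fun D => F C D)
    (hG1 : ∀ D, Monotone fun C => G C D) (hG2 : ∀ C, Antitone fun D => G C D) :
    (∫ ω in {ω : BondConfig V | ∀ x ∈ X, ¬ (openGraph ω).Reachable t x},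
        F (openEdgeCluster ω s) (openEdgeCluster ω t) ∂(prodBernoulli w)) *
      (∫ ω in {ω : BondConfig V | ∀ x ∈ X, ¬ (openGraph ω).Reachable t x},
        G (openEdgeCluster ω s) (openEdgeCluster ω t) ∂(prodBernoulli w)) ≤
    (prodBernoulli w).real {ω : BondConfig V | ∀ x ∈ X, ¬ (openGraph ω).Reachable t x} *
      ∫ ω in {ω : BondConfig V | ∀ x ∈ X, ¬ (openGraph ω).Reachable t x},
        F (openEdgeCluster ω s) (openEdgeCluster ω t) * G (openEdgeCluster ω s) (openEdgeCluster ω t)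
          ∂(prodBernoulli w) := by
  set D : Set (BondConfig V) := {ω | ∀ x ∈ X, ¬ (openGraph ω).Reachable t x} with hDdef
  have hDmem : ∀ ω, ω ∈ D ↔ ∀ x ∈ X, ¬ (openGraph ω).Reachable t x := fun ω => by rw [hDdef]; rfl
  have hDm : MeasurableSet D := MeasurableSet.of_discrete
  set w' : Sym2 V → ℝ := fun e => (w e : ℝ) with hw'
  have hw0 : ∀ e, 0 ≤ w' e := fun e => (w e).2.1
  have hw1 : ∀ e, w' e ≤ 1 := fun e => (w e).2.2
  have hint : ∀ h : Set (Sym2 V) → ℝ,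
      ∫ ω in D, h ω ∂(prodBernoulli w) = ∑ ω, weight w' ω * (h ω * ind D ω) := by
    intro h
    rw [← integral_indicator hDm, integral_prodBernoulli_eq_sum]
    refine Finset.sum_congr rfl fun ω _ => ?_
    by_cases hω : ω ∈ D
    · rw [Set.indicator_of_mem hω, ind_of_mem hω, mul_one]
    · rw [Set.indicator_of_notMem hω, ind_of_not_mem hω]; ring
  have hreal : (prodBernoulli w).real D = ∑ ω, weight w' ω * ind D ω := by
    rw [← integral_indicator_one hDm, integral_prodBernoulli_eq_sum]
    refine Finset.sum_congr rfl fun ω _ => ?_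
    by_cases hω : ω ∈ D
    · rw [Set.indicator_of_mem hω, ind_of_mem hω, Pi.one_apply]
    · rw [Set.indicator_of_notMem hω, ind_of_not_mem hω, mul_zero]
  have hm : ∑ ω, weight w' ω = 1 := by
    have h1 := integral_prodBernoulli_eq_sum w fun _ => (1 : ℝ)
    simp only [integral_const, probReal_univ, smul_eq_mul, mul_one] at h1
    exact h1.symm
  -- negated functions `Fn W C = -F C W`, `Gn W C = -G C W` (first argument = `C_t = W`)
  set Fn : Set (Sym2 V) → Set (Sym2 V) → ℝ := fun W C => -F C W with hFn
  set Gn : Set (Sym2 V) → Set (Sym2 V) → ℝ := fun W C => -G C W with hGn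
  have hFn1 : ∀ C, Monotone fun W => Fn W C := fun C W W' h => neg_le_neg (hF2 C h)
  have hFn2 : ∀ W, Antitone fun C => Fn W C := fun W C C' h => neg_le_neg (hF1 W h)
  have hGn1 : ∀ C, Monotone fun W => Gn W C := fun C W W' h => neg_le_neg (hG2 C h)
  have hGn2 : ∀ W, Antitone fun C => Gn W C := fun W C C' h => neg_le_neg (hG1 W h)
  -- the conditional averages `W ↦ E[Fn(W, C_s) | C_t = W]` are increasing in `W`
  have hf₁ : Monotone fun W => ∑ η, weight w' η *
      Fn W (openEdgeCluster (η \ {e | ∃ v ∈ e, v = t ∨ ∃ e' ∈ W, v ∈ e'}) s) :=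
    condAvg_mono hw0 hw1 s (bar_mono t) hFn1 hFn2
  have hg₁ : Monotone fun W => ∑ η, weight w' η *
      Gn W (openEdgeCluster (η \ {e | ∃ v ∈ e, v = t ∨ ∃ e' ∈ W, v ∈ e'}) s) :=
    condAvg_mono hw0 hw1 s (bar_mono t) hGn1 hGn2
  -- BHK Thm 1.3 for `C_t` given `{C_t ∩ X = ∅}`
  have h13 := BHK2006_clusterConditionalPositiveAssociation_holds V w t X
    (fun W => ∑ η, weight w' η *
      Fn W (openEdgeCluster (η \ {e | ∃ v ∈ e, v = t ∨ ∃ e' ∈ W, v ∈ e'}) s))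
    (fun W => ∑ η, weight w' η *
      Gn W (openEdgeCluster (η \ {e | ∃ v ∈ e, v = t ∨ ∃ e' ∈ W, v ∈ e'}) s))
    hf₁ hg₁ htX
  change (∫ ω in D, _ ∂(prodBernoulli w)) * (∫ ω in D, _ ∂(prodBernoulli w)) ≤
    (prodBernoulli w).real D * ∫ ω in D, _ ∂(prodBernoulli w) at h13
  rw [hint, hint, hint (fun ω =>
    (∑ η, weight w' η * Fn (openEdgeCluster ω t) (openEdgeCluster
      (η \ {e | ∃ v ∈ e, v = t ∨ ∃ e' ∈ openEdgeCluster ω t, v ∈ e'}) s)) *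
    ∑ η, weight w' η * Gn (openEdgeCluster ω t) (openEdgeCluster
      (η \ {e | ∃ v ∈ e, v = t ∨ ∃ e' ∈ openEdgeCluster ω t, v ∈ e'}) s)), hreal] at h13
  -- the three integrals of the goal, conditioned on `C_t`
  rw [hint (fun ω => F (openEdgeCluster ω s) (openEdgeCluster ω t)),
    hint (fun ω => G (openEdgeCluster ω s) (openEdgeCluster ω t)),
    hint (fun ω => F (openEdgeCluster ω s) (openEdgeCluster ω t) *
      G (openEdgeCluster ω s) (openEdgeCluster ω t)), hreal]
  have e1 := rbhk_sum_cond_cluster w' hm t s X hsX (fun Ct Cs => F Cs Ct) hDmem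
  have e2 := rbhk_sum_cond_cluster w' hm t s X hsX (fun Ct Cs => G Cs Ct) hDmem
  have e3 := rbhk_sum_cond_cluster w' hm t s X hsX (fun Ct Cs => F Cs Ct * G Cs Ct) hDmem
  -- Harris on each `{C_t = W}` (both functions increasing in the fresh variables)
  have hH : ∀ ω : Set (Sym2 V),
      (∑ η, weight w' η * F (openEdgeCluster
          (η \ {e | ∃ v ∈ e, v = t ∨ ∃ e' ∈ openEdgeCluster ω t, v ∈ e'}) s) (openEdgeCluster ω t)) *
      (∑ η, weight w' η * G (openEdgeCluster
          (η \ {e | ∃ v ∈ e, v = t ∨ ∃ e' ∈ openEdgeCluster ω t, v ∈ e'}) s) (openEdgeCluster ω t)) ≤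
      ∑ η, weight w' η * (F (openEdgeCluster
          (η \ {e | ∃ v ∈ e, v = t ∨ ∃ e' ∈ openEdgeCluster ω t, v ∈ e'}) s) (openEdgeCluster ω t) *
        G (openEdgeCluster
          (η \ {e | ∃ v ∈ e, v = t ∨ ∃ e' ∈ openEdgeCluster ω t, v ∈ e'}) s) (openEdgeCluster ω t)) := by
    intro ω
    have key := condAvg_mul_le hw0 hw1 hm s {e | ∃ v ∈ e, v = t ∨ ∃ e' ∈ openEdgeCluster ω t, v ∈ e'}
      (F := Fn) (G := Gn) hFn2 hGn2 (openEdgeCluster ω t)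
    have hneg : ∀ (K : Set (Sym2 V) → ℝ), ∑ η, weight w' η * (-K η) = -∑ η, weight w' η * K η := by
      intro K
      rw [← Finset.sum_neg_distrib]
      exact Finset.sum_congr rfl fun η _ => by ring
    simp only [hFn, hGn] at key
    rw [hneg, hneg] at key
    have hprod : ∀ a b : ℝ, -a * -b = a * b := fun a b => by ring
    simp only [hprod] at key
    exact key
  -- rewrite the Thm-1.3 inequality in terms of `F`, `G`
  have hneg2 : ∀ ω : Set (Sym2 V), ∀ K : Set (Sym2 V) → Set (Sym2 V) → ℝ,
      (∑ η, weight w' η * -K (openEdgeCluster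
          (η \ {e | ∃ v ∈ e, v = t ∨ ∃ e' ∈ openEdgeCluster ω t, v ∈ e'}) s) (openEdgeCluster ω t)) =
        -∑ η, weight w' η * K (openEdgeCluster
          (η \ {e | ∃ v ∈ e, v = t ∨ ∃ e' ∈ openEdgeCluster ω t, v ∈ e'}) s) (openEdgeCluster ω t) := by
    intro ω K
    rw [← Finset.sum_neg_distrib]
    exact Finset.sum_congr rfl fun η _ => by ring
  simp only [hFn, hGn, hneg2] at h13
  have hsum_neg : ∀ (K : Set (Sym2 V) → ℝ),
      ∑ ω, weight w' ω * (-K ω * ind D ω) = -∑ ω, weight w' ω * (K ω * ind D ω) := by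
    intro K
    rw [← Finset.sum_neg_distrib]
    exact Finset.sum_congr rfl fun ω _ => by ring
  rw [hsum_neg, hsum_neg] at h13
  have hprod2 : ∀ a b : ℝ, -a * -b = a * b := fun a b => by ring
  simp only [hprod2] at h13
  have hP : 0 ≤ ∑ ω, weight w' ω * ind D ω :=
    Finset.sum_nonneg fun ω _ => mul_nonneg (weight_nonneg hw0 hw1 ω) (ind_nonneg _ _)
  rw [e1, e2, e3]
  refine h13.trans (mul_le_mul_of_nonneg_left ?_ hP)
  exact Finset.sum_le_sum fun ω _ => mul_le_mul_of_nonneg_left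
    (mul_le_mul_of_nonneg_right (hH ω) (ind_nonneg _ _)) (weight_nonneg hw0 hw1 ω)

end RBHK


end

end Summit.CriticalPhenomena.PercolationContinuityZ3.Theorems
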